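import Summits.Schanuel.Schanuel.Theses.RoyCriterion
import Literature.Barriers.Schanuel.LargeTranscendenceDegreeThm29Holds
import Literature.Barriers.Schanuel.LargeTranscendenceDegreeTwoTwoProofs

-- `Summit.Schanuel.Schanuel.…` is the mandated layout of this single-problem summit (CONVENTIONS §1).
set_option linter.dupNamespace false

/-!
# `GridTwoTwo_special` — WITNESS / LADDER file for line `Lines/GridTwoTwo.lean` (crux `SchanuelTwo`,
stmt-Schanuel-0069; G4 ladder-down, fwd-ladder-Schanuel-50).  SORRY-FREE.

Everything the line card claims about the ladder, kernel-checked: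

* the graded family `Rung m n` (rung_decl `Summit.Schanuel.Schanuel.Cruxes.SchanuelTwo.GridLadder.Rung`):
  for `ℚ`-free `x : Fin m → ℂ`, `y : Fin n → ℂ`, `2 ≤ trdeg_ℚ ℚ(x, y, e^{xᵢyⱼ})`
  (`Literature.Barriers.Schanuel.gridField₂`, the `K₂` of LNM 1752 Ch. 14 Conj. 2.3 / Thm 2.9);
* TOP:     `schanuelTwo_iff_rung_one_two : SchanuelTwo ↔ Rung 1 2` (and `↔ Rung 2 1`);
* ON-PATH: `rung_of_schanuelTwo : SchanuelTwo → Rung m n` (`1 ≤ m`, `2 ≤ n`), `ladder_of_crux`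
  (the crux implies every stub of the line: `OneAlgExp ∧ AllTranscExp ∧ Descent ∧ GridTwoTwo ∧ Rung 3 2`);
* DIRECTION: `Rung.mono : m ≤ m' → n ≤ n' → Rung m n → Rung m' n'`, `rung_swap_iff : Rung m n ↔ Rung n m`;
* WITNESSES (the proved special cases, floor of the ladder):
  `rung_three_two : Rung 3 2`, `rung_two_three : Rung 2 3`, `rung_of_add_lt_mul : n + m < m * n → Rung m n`
  (LNM 1752 Ch. 14 Thm 2.9 `t₂` = tree theorem `Literature.Barriers.Schanuel.two_le_trdeg_gridField₂`), and
  `rungBW_two : RungBW 2` (Brownawell–Waldschmidt = `Literature.Barriers.Schanuel.smallTrdeg_thm_2_9_two_two_holds`);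
* NEXT RUNG = the line's stubs: `GridTwoTwo (= Rung 2 2) ⟸ OneAlgExp (= RungBW 1) ∧ AllTranscExp`
  (`gridTwoTwo_of_cases`, proved), `rungBW_zero_iff`, `rungBW_one_iff`, `RungBW.mono`;
* COMPOSITION: `crux_of_ladder : OneAlgExp → AllTranscExp → Descent → SchanuelTwo` (proved; the line file
  `Lines/GridTwoTwo.lean` is this with the three hypotheses as `sorry` stubs).
Gradation table, sources and stopping points: `LADDER-SchanuelTwo.md` in this crux directory.
-/

noncomputable section

open Complex IntermediateField
open Literature.Barriers.Schanuel (gridField₂ trdeg_mono two_le_trdeg_gridField₂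
  smallTrdeg_thm_2_9_two_two_holds)
open Literature.NumberTheory.Transcendental (gridField₂_swap)

namespace Summit.Schanuel.Schanuel.Cruxes.SchanuelTwo.GridLadder

/-- The crux, by name. -/
abbrev Crux : Prop := Summit.Schanuel.Schanuel.Theses.RoyCriterion.SchanuelTwo

/-! ### The graded family -/

/-- **The grid ladder.** `Rung m n`: for `ℚ`-linearly independent `x : Fin m → ℂ` and
`y : Fin n → ℂ`, `2 ≤ trdeg_ℚ ℚ(x, y, e^{xᵢyⱼ})` (`gridField₂ x y`). -/
def Rung (m n : ℕ) : Prop :=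
  ∀ (x : Fin m → ℂ) (y : Fin n → ℂ), LinearIndependent ℚ x → LinearIndependent ℚ y →
    (2 : Cardinal) ≤ Algebra.trdeg ℚ (gridField₂ x y)

/-- **The sub-ladder of the `(2,2)` cell** by the number `k` of algebraic exponentials in row `0`:
`RungBW 2` = Brownawell–Waldschmidt (proved), `RungBW 1` = one algebraic exponential (open),
`RungBW 0 ↔ Rung 2 2`. -/
def RungBW (k : ℕ) : Prop :=
  ∀ (x y : Fin 2 → ℂ), LinearIndependent ℚ x → LinearIndependent ℚ y →
    (∀ j : Fin 2, (j : ℕ) < k → IsAlgebraic ℚ (cexp (x 0 * y j))) →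
    (2 : Cardinal) ≤ Algebra.trdeg ℚ (gridField₂ x y)

/-- Next rung (crux #1 of the line): the `(2,2)` cell = Conjecture 2.3 (`t₂`, `d = ℓ = 2`). -/
def GridTwoTwo : Prop :=
  ∀ (x y : Fin 2 → ℂ), LinearIndependent ℚ x → LinearIndependent ℚ y →
    (2 : Cardinal) ≤ Algebra.trdeg ℚ (gridField₂ x y)

/-- The top cell `(1,2)` (equivalent to the crux). -/
def GridOneTwo : Prop :=
  ∀ (x : Fin 1 → ℂ) (y : Fin 2 → ℂ), LinearIndependent ℚ x → LinearIndependent ℚ y →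
    (2 : Cardinal) ≤ Algebra.trdeg ℚ (gridField₂ x y)

/-- `(2,2)` with ONE algebraic exponential (B–W minus one hypothesis; `= RungBW 1`). -/
def OneAlgExp : Prop :=
  ∀ (x y : Fin 2 → ℂ), LinearIndependent ℚ x → LinearIndependent ℚ y →
    IsAlgebraic ℚ (cexp (x 0 * y 0)) →
    (2 : Cardinal) ≤ Algebra.trdeg ℚ (gridField₂ x y)

/-- `(2,2)` with all four exponentials transcendental (the complementary regime). -/
def AllTranscExp : Prop :=
  ∀ (x y : Fin 2 → ℂ), LinearIndependent ℚ x → LinearIndependent ℚ y →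
    (∀ i j, Transcendental ℚ (cexp (x i * y j))) →
    (2 : Cardinal) ≤ Algebra.trdeg ℚ (gridField₂ x y)

/-- The last step of the ladder (gap): the `(2,2)` cell implies the `(1,2)` cell. -/
def Descent : Prop := GridTwoTwo → GridOneTwo

theorem gridTwoTwo_iff : GridTwoTwo ↔ Rung 2 2 := Iff.rfl

theorem gridOneTwo_iff : GridOneTwo ↔ Rung 1 2 := Iff.rfl

/-! ### Linear-independence helpers -/

/-- Scaling by a non-zero complex number keeps `ℚ`-linear independence. -/
theorem linearIndependent_const_mul {ι : Type*} [Fintype ι] {y : ι → ℂ}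
    (hy : LinearIndependent ℚ y) {c : ℂ} (hc : c ≠ 0) :
    LinearIndependent ℚ (fun j => c * y j) := by
  rw [Fintype.linearIndependent_iff] at hy ⊢
  intro g hg
  apply hy g
  have h1 : ∑ i, g i • (c * y i) = c * ∑ i, g i • y i := by
    rw [Finset.mul_sum]
    refine Finset.sum_congr rfl fun i _ => ?_
    rw [mul_smul_comm]
  rw [h1] at hg
  exact (mul_eq_zero.mp hg).resolve_left hc

/-- The first two coordinates `Fin 2 ↪ Fin n` (`n ≥ 2`). -/
def firstTwo {n : ℕ} (hn : 2 ≤ n) : Fin 2 → Fin n := fun j => ⟨j.val, lt_of_lt_of_le j.isLt hn⟩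

theorem firstTwo_injective {n : ℕ} (hn : 2 ≤ n) : Function.Injective (firstTwo hn) := by
  intro a b h
  exact Fin.ext (by simpa [firstTwo] using congrArg Fin.val h)

/-! ### Reindexing and symmetry of the grid field -/

/-- Permuting the indices of `x` and of `y` does not change `ℚ(x, y, e^{xᵢyⱼ})`. -/
theorem gridField₂_comp_equiv {m n : ℕ} (x : Fin m → ℂ) (y : Fin n → ℂ)
    (σ : Equiv.Perm (Fin m)) (τ : Equiv.Perm (Fin n)) :
    gridField₂ (x ∘ σ) (y ∘ τ) = gridField₂ x y := by
  show adjoin ℚ _ = adjoin ℚ _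
  congr 1
  rw [σ.surjective.range_comp, τ.surjective.range_comp]
  congr 1
  have : (fun p : Fin m × Fin n => cexp ((x ∘ σ) p.1 * (y ∘ τ) p.2)) =
      (fun p : Fin m × Fin n => cexp (x p.1 * y p.2)) ∘ (Prod.map σ τ) := by
    funext p; rfl
  rw [this, (σ.surjective.prodMap τ.surjective).range_comp]

/-- `Rung m n → Rung n m` (the grid is symmetric: `gridField₂_swap`). -/
theorem Rung.swap {m n : ℕ} (h : Rung m n) : Rung n m := fun x y hx hy =>
  (h y x hy hx).trans (trdeg_mono (gridField₂_swap y x).le)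

theorem rung_swap_iff {m n : ℕ} : Rung m n ↔ Rung n m := ⟨Rung.swap, Rung.swap⟩

/-- **Monotonicity (direction of difficulty).** More rows/columns = more numbers for the same
bound `2`: `Rung m n → Rung m' n'` whenever `m ≤ m'`, `n ≤ n'` (restrict to a sub-grid). -/
theorem Rung.mono {m n m' n' : ℕ} (hm : m ≤ m') (hn : n ≤ n') (h : Rung m n) : Rung m' n' := by
  intro x y hx hy
  have hx' : LinearIndependent ℚ (x ∘ Fin.castLE hm) := hx.comp _ (Fin.castLE_injective hm)
  have hy' : LinearIndependent ℚ (y ∘ Fin.castLE hn) := hy.comp _ (Fin.castLE_injective hn)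
  refine (h _ _ hx' hy').trans (trdeg_mono ?_)
  refine adjoin.mono ℚ _ _ ?_
  rintro w ((⟨i, rfl⟩ | ⟨j, rfl⟩) | ⟨p, rfl⟩)
  · exact Or.inl (Or.inl ⟨Fin.castLE hm i, rfl⟩)
  · exact Or.inl (Or.inr ⟨Fin.castLE hn j, rfl⟩)
  · exact Or.inr ⟨(Fin.castLE hm p.1, Fin.castLE hn p.2), rfl⟩

/-! ### The top: `Rung 1 2 ↔ SchanuelTwo`, and the on-path implications -/

/-- **On-path** (`Crux → Rung`): Schanuel for `n = 2`, applied to the `ℚ`-free pair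
`(x₀y₀, x₀y₁)`, gives every rung with `m ≥ 1`, `n ≥ 2`. -/
theorem rung_of_schanuelTwo (h : Crux) {m n : ℕ} (hm : 1 ≤ m) (hn : 2 ≤ n) : Rung m n := by
  intro x y hx hy
  set i0 : Fin m := ⟨0, hm⟩
  have hx0 : x i0 ≠ 0 := hx.ne_zero i0
  set z : Fin 2 → ℂ := fun j => x i0 * y (firstTwo hn j) with hz_def
  have hz : LinearIndependent ℚ z :=
    linearIndependent_const_mul (hy.comp _ (firstTwo_injective hn)) hx0
  refine (h z hz).trans (trdeg_mono ?_)
  rw [adjoin_le_iff]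
  rintro w (⟨j, rfl⟩ | ⟨j, rfl⟩)
  · show x i0 * y (firstTwo hn j) ∈ gridField₂ x y
    exact mul_mem (subset_adjoin ℚ _ (Or.inl (Or.inl ⟨i0, rfl⟩)))
      (subset_adjoin ℚ _ (Or.inl (Or.inr ⟨firstTwo hn j, rfl⟩)))
  · show cexp (x i0 * y (firstTwo hn j)) ∈ gridField₂ x y
    exact subset_adjoin ℚ _ (Or.inr ⟨(i0, firstTwo hn j), rfl⟩)

/-- **Top, downward direction**: the `(1,2)` cell gives the crux (take `x = (1)`; then
`ℚ(1, y, e^{1·yⱼ}) ⊆ ℚ(y, e^y)`). -/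
theorem schanuelTwo_of_rung_one_two (h : Rung 1 2) : Crux := by
  intro y hy
  have h1 : LinearIndependent ℚ (fun _ : Fin 1 => (1 : ℂ)) :=
    linearIndependent_unique_iff.mpr one_ne_zero
  refine (h (fun _ => 1) y h1 hy).trans (trdeg_mono ?_)
  change adjoin ℚ _ ≤ _
  rw [adjoin_le_iff]
  rintro w ((⟨i, rfl⟩ | ⟨j, rfl⟩) | ⟨p, rfl⟩)
  · exact (adjoin ℚ _).one_mem
  · exact subset_adjoin ℚ _ (Or.inl ⟨j, rfl⟩)
  · show cexp (1 * y p.2) ∈ adjoin ℚ (Set.range y ∪ Set.range (cexp ∘ y))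
    rw [one_mul]
    exact subset_adjoin ℚ _ (Or.inr ⟨p.2, rfl⟩)

/-- **TOP EQUIVALENCE**: `SchanuelTwo ↔ Rung 1 2`. -/
theorem schanuelTwo_iff_rung_one_two : Crux ↔ Rung 1 2 :=
  ⟨fun h => rung_of_schanuelTwo h le_rfl le_rfl, schanuelTwo_of_rung_one_two⟩

/-- … and `SchanuelTwo ↔ Rung 2 1`. -/
theorem schanuelTwo_iff_rung_two_one : Crux ↔ Rung 2 1 :=
  schanuelTwo_iff_rung_one_two.trans rung_swap_iff

/-- On-path for the next rung: `SchanuelTwo → Rung 2 2` (= `GridTwoTwo`). -/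
theorem gridTwoTwo_of_schanuelTwo (h : Crux) : GridTwoTwo :=
  rung_of_schanuelTwo h (by norm_num) le_rfl

/-- `GridOneTwo → Crux` by name. -/
theorem schanuelTwo_of_gridOneTwo (h : GridOneTwo) : Crux := schanuelTwo_of_rung_one_two h

/-! ### The floor (witnesses, no sorry) -/

/-- **FLOOR** (LNM 1752 Ch. 14 Thm 2.9, `t₂`; PROVED in tree): every cell with `m + n < mn`. -/
theorem rung_of_add_lt_mul {m n : ℕ} (h : n + m < m * n) : Rung m n :=
  fun x y hx hy => two_le_trdeg_gridField₂ x y hx hy h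

/-- Witness `(3,2)`: e.g. `trdeg ℚ(e, e^e, e^{e²}, e^{e³}) ≥ 2` (`x = (1,e,e²)`, `y = (1,e)`). -/
theorem rung_three_two : Rung 3 2 := rung_of_add_lt_mul (by norm_num)

theorem rung_two_three : Rung 2 3 := rung_of_add_lt_mul (by norm_num)

/-- Witness inside the `(2,2)` cell: `RungBW 2` = Brownawell–Waldschmidt (PROVED in tree). -/
theorem rungBW_two : RungBW 2 := fun x y hx hy halg =>
  smallTrdeg_thm_2_9_two_two_holds x y hx hy (halg 0 (by simp)) (halg 1 (by simp))

/-- `RungBW` gets easier with `k` (more hypotheses). -/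
theorem RungBW.mono {k k' : ℕ} (hk : k ≤ k') (h : RungBW k) : RungBW k' :=
  fun x y hx hy halg => h x y hx hy (fun j hj => halg j (lt_of_lt_of_le hj hk))

theorem rungBW_zero_iff : RungBW 0 ↔ Rung 2 2 := by
  constructor
  · intro h x y hx hy
    exact h x y hx hy (fun j hj => absurd hj (Nat.not_lt_zero _))
  · intro h x y hx hy _
    exact h x y hx hy

theorem rungBW_one_iff : RungBW 1 ↔ OneAlgExp := by
  constructor
  · intro h x y hx hy h0
    refine h x y hx hy (fun j hj => ?_)
    have hj0 : j = 0 := Fin.ext (by simp only [Fin.val_zero]; omega)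
    subst hj0
    exact h0
  · intro h x y hx hy hj
    exact h x y hx hy (hj 0 (by simp))

/-! ### The next rung from its two regimes, and the ladder composition -/

/-- `Rung 2 2` from its two regimes (some `e^{xᵢyⱼ}` algebraic — moved to position `(0,0)` by
permuting indices — or all four transcendental). PROVED. -/
theorem gridTwoTwo_of_cases (h1 : OneAlgExp) (h0 : AllTranscExp) : GridTwoTwo := by
  intro x y hx hy
  by_cases H : ∃ i j, IsAlgebraic ℚ (cexp (x i * y j))
  · obtain ⟨i, j, hij⟩ := H
    have hx' : LinearIndependent ℚ (x ∘ Equiv.swap 0 i) := hx.comp _ (Equiv.injective _)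
    have hy' : LinearIndependent ℚ (y ∘ Equiv.swap 0 j) := hy.comp _ (Equiv.injective _)
    have key := h1 (x ∘ Equiv.swap 0 i) (y ∘ Equiv.swap 0 j) hx' hy'
      (by simpa [Equiv.swap_apply_left] using hij)
    exact key.trans (trdeg_mono (gridField₂_comp_equiv x y (Equiv.swap 0 i) (Equiv.swap 0 j)).le)
  · simp only [not_exists] at H
    exact h0 x y hx hy H

/-- The grid ladder down to the crux: floor `(3,2)` ⟸ next rung `(2,2)` ⟸ top `(1,2)` = crux;
formally `OneAlgExp → AllTranscExp → Descent → Crux`. PROVED composition. -/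
theorem crux_of_ladder (h1 : OneAlgExp) (h0 : AllTranscExp) (hd : Descent) : Crux :=
  schanuelTwo_of_gridOneTwo (hd (gridTwoTwo_of_cases h1 h0))

/-- The whole ladder is a chain of consequences of the crux (on-path for every piece). -/
theorem ladder_of_crux (h : Crux) : OneAlgExp ∧ AllTranscExp ∧ Descent ∧ GridTwoTwo ∧ Rung 3 2 :=
  ⟨fun x y hx hy _ => gridTwoTwo_of_schanuelTwo h x y hx hy,
   fun x y hx hy _ => gridTwoTwo_of_schanuelTwo h x y hx hy,
   fun _ => (schanuelTwo_iff_rung_one_two.mp h), gridTwoTwo_of_schanuelTwo h,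
   Rung.mono (by norm_num) le_rfl (gridTwoTwo_of_schanuelTwo h)⟩

end Summit.Schanuel.Schanuel.Cruxes.SchanuelTwo.GridLadder

end
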